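import Summits.QuantumAdvantage.QuantumAdvantage.Theorems.ArithStatLadderIqThreeNotPPoly
import Summits.QuantumAdvantage.QuantumAdvantage.Theorems.ArithStatLadderIqThreeNotBPPRURClosure
import Summits.QuantumAdvantage.QuantumAdvantage.Theorems.ArithStatLadderIqThreeNotBPPStubOrderThree
import Summits.QuantumAdvantage.QuantumAdvantage.Theorems.ArithStatLadderIqThreeNotBPPStubCubeDensity
import Summits.QuantumAdvantage.QuantumAdvantage.Theorems.ArithStatLadderIqThreeNotBPPStubCubeHit
import Summits.QuantumAdvantage.QuantumAdvantage.Theorems.ArithStatLadderIqThreeNotBPPStubSamplerCubeFP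

/-!
# Line `Sketch` for the crux `ArithStatLadder.IqThreeNotBPP` (stmt-QuantumAdvantage-14864)

Skeleton v4 = FINAL (v3 with ALL provable stubs LANDED and imported: `stub_rurClosureBPP` p100614,
`stub_orderThreeCert` p99458, `stub_cubeHit` p101053, `stub_cubeDensity` p101337, `stub_samplerCubeFP` p102512 —
restated below as aliases of the landed theorems; the ONLY `sorry` left is the apex `stub_sqfreeNotBPP`,
hypothesis-type). History: skeleton v3 (line lead `prover-line-stmt-QuantumAdvantage-14864-0`), the UNIFORM SQUAREFREE-FILTER
DOMINATION, now **CLASS-FIELD-THEORY-FREE**. v1/v2 (`Lines/Sketch.lean` @751ef94d): the four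
provable stubs of the uniform closure `stub_orQueryFP` p96820, `stub_orVerdictP` p96860,
`stub_blockMissProb` p96725, `stub_expQuarter` p96679 LANDED (wave 1) and the closure
`mem_BPP_of_rurReduction` is PROVED in the lead's folder (`work/final/RURClosure.lean`, rc0, landing
queued behind the farm rebuild) — it enters here as the statement-stub `stub_rurClosureBPP`; the v2
socket `stub_hasseDictionary` (Hasse 1930, class field theory) is REMOVED: v3 replaces the
sibling's cubic-field sampler `d = N t (27 N t − 4)` + Hasse's dictionary by a NAGELL-TYPE PLANTED
FAMILY whose YES-certificate is an EXPLICIT ideal class of order `3` (`stub_orderThreeCert`, PROVED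
by the lead: `work/stubs/StubOrderThree.lean`, rc0, axioms standard):

* input numeral `N` (`n = |bin N|`), seed value `j < 2^{6n+60}`; `M := N/2` if `N` even else `N`;
  `U := 6·M·2^{3n+32} ± 1` (sign `−` iff `M ≡ 2 (mod 3)`, so that `3 ∤ 2U³ − M`);
  `s := 1 + 6·M·U·j`; output `d := 0` if `4 ∣ N`, else `d := 4·M·s·(2U³ − M·s)`;
* NO side (exact, PROVED below): `N` not squarefree ⇒ `4 ∣ N` (output `0`) or an odd `p² ∣ M`,
  `M ∣ d/4` ⇒ `−d` is never fundamental (`cubeD_not_mem_of_not_squarefree`);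
* YES side: for squarefree `N`, `M` is odd squarefree, `< 2ⁿ`, and whenever `M s ≤ U³` and `s`,
  `w := 2U³ − M s` are squarefree (`≥ 1/4` of the seeds: two arithmetic progressions in `j`
  sieved by the LANDED `stub_apSieve` with `p₀ = 5` — `stub_cubeDensity`), `m' := M s w =
  U⁶ − (U³ − M s)²` is squarefree, `≡ 1 (mod 4)`, `> U²`, so `−4m'` is fundamental AND
  `3 ∣ h(−4m')` by the certificate (`stub_cubeHit ∘ stub_orderThreeCert`): `d ∈ S`.

Registered stubs: CLOSED (landed) `stub_rurClosureBPP`, `stub_samplerCubeFP`, `stub_cubeDensity`,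
`stub_cubeHit`, `stub_orderThreeCert`; OPEN (the one `sorry`): `stub_sqfreeNotBPP` (THE APEX,
hypothesis-type, crux-sized, never staffed). `IqThreeNotBPP_of` concludes the crux BY NAME; the deliverable
`toLanguage_squarefree_mem_BPP_of_iqThree_cube : IQ3 ∈ BPP → SQF ∈ BPP` is UNCONDITIONAL modulo the
provable stubs (no named fact, no CFT).
-/

set_option linter.unusedVariables false
set_option linter.dupNamespace false

noncomputable section

namespace Summit.QuantumAdvantage.QuantumAdvantage.Cruxes.IqThreeNotBPP.Sketch

open scoped Classical
open _root_.Computability Polynomial Finset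
open Literature.Computability.Complexity
open Literature.Computability.Cryptography (IsNegFundamentalDiscr)
open Literature.NumberTheory.QuadraticFields (BinaryQuadraticForm.classNumber)
open Summit.QuantumAdvantage.QuantumAdvantage.Theses.ArithStatLadder (IqThreeNotBPP)
open Summit.QuantumAdvantage.QuantumAdvantage.Theorems.IqThreeNotPPoly
  (stub_natAdapter card_filter_seeds encodeNat_mem_toLanguage_iff
    nil_not_mem_iqThreeLanguage not_isNegFundamentalDiscr_zero)

/-! ## The registered stubs -/

/-- **STUB R · `stub_rurClosureBPP`** (PROVED by the lead, `work/final/RURClosure.lean` →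
`Theorems/ArithStatLadderIqThreeNotBPPRURClosure.lean`, landing queued): `BPP` is closed downwards
under one-sided randomized polynomial-time many-one reductions with success `≥ 1/q(n)` from `n₀` on. -/
theorem stub_rurClosureBPP :
    ∀ (L₁ L₂ : Language Bool) (f : List Bool → List Bool), f ∈ FP →
      ∀ (ℓ : ℕ → ℕ) (ℓp q : Polynomial ℕ) (n₀ : ℕ), (∀ n, ℓ n = ℓp.eval n) →
        (∀ x : List Bool, x ∉ L₁ → ∀ r : List Bool, f (boolPair x r) ∉ L₂) →
        (∀ x : List Bool, x ∈ L₁ → n₀ ≤ x.length →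
          2 ^ (ℓ x.length) ≤ q.eval x.length *
            (univ.filter (fun r : Fin (ℓ x.length) → Bool =>
              f (boolPair x (List.ofFn r)) ∈ L₂)).card) →
        L₂ ∈ BPP → L₁ ∈ BPP :=
  Theorems.IqThreeNotBPP.stub_rurClosureBPP

/-- **STUB F · `stub_samplerCubeFP`** (provable, M–L; CodeFP algebra): the planted sampler is an
`FP` string function of `⟨x, r⟩`. -/
theorem stub_samplerCubeFP :
    ∃ f : List Bool → List Bool, f ∈ FP ∧ ∀ x r : List Bool,
      f (boolPair x r) = encodeNat
        (let N := bitsToNat x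
         let n := x.length
         let j := bitsToNat r
         let M := if N % 2 = 0 then N / 2 else N
         let U := if M % 3 = 2 then 6 * M * 2 ^ (3 * n + 32) - 1 else 6 * M * 2 ^ (3 * n + 32) + 1
         let s := 1 + 6 * M * U * j
         if N % 4 = 0 then 0 else 4 * (M * s * (2 * U ^ 3 - M * s))) :=
  Theorems.IqThreeNotBPP.stub_samplerCubeFP

/-- **STUB D · `stub_cubeDensity`** (provable, L; from the LANDED AP sieve `stub_apSieve` with
`p₀ = 5` on the two progressions `s = 1 + 6MU·j` and `2U³ − Ms = (2U³ − M) − 6M²U·j`): for odd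
`M < 2ⁿ`, `n ≥ n₀`, at least a quarter of the seeds `j < 2^{6n+60}` have `M s ≤ U³` and both `s` and
`2U³ − M s` squarefree. -/
theorem stub_cubeDensity :
    ∃ n₀ : ℕ, ∀ n, n₀ ≤ n → ∀ M : ℕ, Odd M → M < 2 ^ n →
      let U := if M % 3 = 2 then 6 * M * 2 ^ (3 * n + 32) - 1 else 6 * M * 2 ^ (3 * n + 32) + 1
      2 ^ (6 * n + 60) ≤ 4 * ((Finset.range (2 ^ (6 * n + 60))).filter (fun j =>
        M * (1 + 6 * M * U * j) ≤ U ^ 3 ∧ Squarefree (1 + 6 * M * U * j) ∧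
          Squarefree (2 * U ^ 3 - M * (1 + 6 * M * U * j)))).card :=
  Theorems.IqThreeNotBPP.stub_cubeDensity

/-- **STUB H · `stub_cubeHit`** (provable, M; elementary): granting the order-3 certificate (the
antecedent, = `stub_orderThreeCert`), a good seed of an odd squarefree `M` yields a member of `S`:
`m' = M s (2U³ − Ms) = U⁶ − (U³ − Ms)²` is squarefree (pairwise coprime squarefree factors:
`s ≡ 1 (mod 6MU)`, `U ≡ ±1 (mod 6M)`), `> U²`, and `U > 1` is odd. -/
theorem stub_cubeHit :
    (∀ u x n : ℕ, Odd u → 1 < u → u ^ 6 = x ^ 2 + n → Squarefree n → u ^ 2 < n →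
      3 ∣ BinaryQuadraticForm.classNumber (-(4 * (n : ℤ)))) →
    ∀ n M j : ℕ, Odd M → Squarefree M →
      let U := if M % 3 = 2 then 6 * M * 2 ^ (3 * n + 32) - 1 else 6 * M * 2 ^ (3 * n + 32) + 1
      let s := 1 + 6 * M * U * j
      M * s ≤ U ^ 3 → Squarefree s → Squarefree (2 * U ^ 3 - M * s) →
        4 * (M * s * (2 * U ^ 3 - M * s)) ∈
          {d : ℕ | IsNegFundamentalDiscr d ∧ 3 ∣ BinaryQuadraticForm.classNumber (-(d : ℤ))} :=
  Theorems.IqThreeNotBPP.stub_cubeHit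

/-- **STUB C · `stub_orderThreeCert`** (PROVED by the lead, `work/stubs/StubOrderThree.lean` →
`Theorems/ArithStatLadderIqThreeNotBPPStubOrderThree.lean`; Nagell 1922, NO class field theory): if
`u⁶ = x² + n` with `u > 1` odd, `n` squarefree and `n > u²`, then `3 ∣ h(−4n)` — the class of the
lattice ideal `(u², x + √−n)` has order exactly `3`. -/
theorem stub_orderThreeCert :
    ∀ u x n : ℕ, Odd u → 1 < u → u ^ 6 = x ^ 2 + n → Squarefree n → u ^ 2 < n →
      3 ∣ BinaryQuadraticForm.classNumber (-(4 * (n : ℤ))) :=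
  Theorems.IqThreeNotBPP.stub_orderThreeCert

/-- **STUB X · `stub_sqfreeNotBPP`** (THE APEX; hypothesis-type, crux-sized — SQUAREFREES ∉ BPP,
Adleman–McCurley's open problem in the uniform setting; never staffed; registered so that the
composition concludes the crux by name). -/
theorem stub_sqfreeNotBPP : encodingNatBool.toLanguage {m : ℕ | Squarefree m} ∉ BPP := by
  sorry

/-! ## Proved glue: vocabulary -/

/-- The planted output on the numeral `N` of bit-length `n` and the seed value `j` (a name for the
sampler's value; unfolds to the stub's `let`-expression). -/
def cubeD (N n j : ℕ) : ℕ :=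
  let M := if N % 2 = 0 then N / 2 else N
  let U := if M % 3 = 2 then 6 * M * 2 ^ (3 * n + 32) - 1 else 6 * M * 2 ^ (3 * n + 32) + 1
  let s := 1 + 6 * M * U * j
  if N % 4 = 0 then 0 else 4 * (M * s * (2 * U ^ 3 - M * s))

/-- The crux's set `S = {d : −d fundamental, 3 ∣ h(−d)}`. -/
def iqThreeSet : Set ℕ :=
  {d : ℕ | IsNegFundamentalDiscr d ∧ 3 ∣ BinaryQuadraticForm.classNumber (-(d : ℤ))}

/-! ## Proved glue: the NO side (exact) -/

/-- **The filter**: `4k ∉ S` whenever `k` is not squarefree (`−4k ≢ 1 (mod 4)`, and the second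
branch needs `−k` squarefree). -/
theorem four_mul_not_mem_iqThreeSet {k : ℕ} (hk : ¬ Squarefree k) : 4 * k ∉ iqThreeSet := by
  rintro ⟨hfund, -⟩
  rcases hfund with ⟨h1, -, -⟩ | ⟨-, -, h3⟩
  · omega
  · apply hk
    have e : (-((4 * k : ℕ) : ℤ)) / 4 = -(k : ℤ) := by push_cast; omega
    rw [e, ← Int.squarefree_natAbs, Int.natAbs_neg, Int.natAbs_natCast] at h3
    exact h3

/-- A non-squarefree `N` with `4 ∤ N` has a prime `p` with `p² ∣ M`, `M = N/2` resp. `N`. -/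
theorem exists_prime_sq_dvd_half {N : ℕ} (hN : ¬ Squarefree N) (h4 : ¬ N % 4 = 0) :
    ∃ p : ℕ, p.Prime ∧ p * p ∣ (if N % 2 = 0 then N / 2 else N) := by
  obtain ⟨p, hp, hpp⟩ : ∃ p, Nat.Prime p ∧ p * p ∣ N := by
    by_contra h
    push Not at h
    exact hN (Nat.squarefree_iff_prime_squarefree.2 h)
  have hp2 : p ≠ 2 := by
    rintro rfl
    omega
  refine ⟨p, hp, ?_⟩
  split_ifs with h2
  · have hN2 : N = (N / 2) * 2 := by omega
    have hcop : Nat.Coprime (p * p) 2 :=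
      Nat.Coprime.mul_left ((Nat.coprime_primes hp Nat.prime_two).2 hp2)
        ((Nat.coprime_primes hp Nat.prime_two).2 hp2)
    rw [hN2] at hpp
    exact hcop.dvd_of_dvd_mul_right hpp
  · exact hpp

/-- **NO side (exact)**: a non-squarefree `N` never yields a member of `S`, for every length
parameter and every seed. -/
theorem cubeD_not_mem_of_not_squarefree {N : ℕ} (hN : ¬ Squarefree N) (n j : ℕ) :
    cubeD N n j ∉ iqThreeSet := by
  unfold cubeD
  dsimp only
  by_cases h4 : N % 4 = 0
  · rw [if_pos h4]
    exact fun h => not_isNegFundamentalDiscr_zero h.1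
  · rw [if_neg h4]
    apply four_mul_not_mem_iqThreeSet
    obtain ⟨p, hp, hpM⟩ := exists_prime_sq_dvd_half hN h4
    intro hsq
    exact hp.one_lt.ne' (Nat.isUnit_iff.1 (hsq p ((hpM.mul_right _).mul_right _)))

/-! ## Proved glue: the YES side bookkeeping -/

/-- A squarefree `N` has `4 ∤ N`. -/
theorem not_four_dvd_of_squarefree {N : ℕ} (hN : Squarefree N) : ¬ N % 4 = 0 := by
  intro h4
  have h := Nat.isUnit_iff.1 (hN 2 (by omega))
  omega

/-- For squarefree `N`: `M = N/2` (if `N` even) resp. `N` is odd and squarefree. -/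
theorem odd_and_squarefree_half {N : ℕ} (hN : Squarefree N) :
    Odd (if N % 2 = 0 then N / 2 else N) ∧ Squarefree (if N % 2 = 0 then N / 2 else N) := by
  have h4 := not_four_dvd_of_squarefree hN
  split_ifs with h2
  · refine ⟨?_, ?_⟩
    · rw [Nat.odd_iff]; omega
    · exact hN.squarefree_of_dvd ⟨2, by omega⟩
  · exact ⟨Nat.odd_iff.2 (by omega), hN⟩

/-! ## Proved glue: the domination `IQ3 ∈ BPP → SQF ∈ BPP` (unconditional modulo the stubs) -/

/-- **`IQ3 ∈ BPP → SQUAREFREES ∈ BPP`**, class-field-theory-free: the planted sampler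
`stub_samplerCubeFP` guarded by the landed `stub_natAdapter`, exact NO side
`cubeD_not_mem_of_not_squarefree`, YES-density `≥ 1/4` by `stub_cubeDensity`, hits certified by
`stub_cubeHit ∘ stub_orderThreeCert`, fed to the uniform closure `stub_rurClosureBPP` with seed length
`ℓ(n) = 6n + 60` and success polynomial `4`. -/
theorem toLanguage_squarefree_mem_BPP_of_iqThree_cube
    (hIQ : encodingNatBool.toLanguage iqThreeSet ∈ BPP) :
    encodingNatBool.toLanguage {m : ℕ | Squarefree m} ∈ BPP := by
  obtain ⟨f, hf, hfval⟩ := stub_samplerCubeFP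
  obtain ⟨f', hf', hcanon, hjunk⟩ := stub_natAdapter f hf []
  obtain ⟨n₀, hdens⟩ := stub_cubeDensity
  refine stub_rurClosureBPP (encodingNatBool.toLanguage {m : ℕ | Squarefree m})
    (encodingNatBool.toLanguage iqThreeSet) f' hf' (fun n => 6 * n + 60) (6 * X + 60) 4 n₀
    (fun n => by simp) ?_ ?_ hIQ
  · -- NO side (exact): non-squarefree numerals by the filter, non-numerals by the guard
    intro x hx r
    by_cases hcx : ∃ m : ℕ, encodeNat m = x
    · obtain ⟨m, rfl⟩ := hcx
      have hm : ¬ Squarefree m := fun h =>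
        hx ((encodeNat_mem_toLanguage_iff {m : ℕ | Squarefree m} m).2 h)
      rw [hcanon, hfval, bitsToNat_encodeNat, encodeNat_mem_toLanguage_iff]
      exact cubeD_not_mem_of_not_squarefree hm (encodeNat m).length (bitsToNat r)
    · rw [hjunk x r (fun m hm => hcx ⟨m, hm⟩)]
      exact nil_not_mem_iqThreeLanguage
  · -- YES side (density ≥ 1/4): good seeds give members of `S`
    intro x hx hn
    obtain ⟨N, hN, hNx⟩ := hx
    change encodeNat N = x at hNx
    subst hNx
    have hsq : Squarefree N := hN
    have h4 : ¬ N % 4 = 0 := not_four_dvd_of_squarefree hsq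
    have hNlt : N < 2 ^ (encodeNat N).length := by
      have h := bitsToNat_lt (encodeNat N)
      rwa [bitsToNat_encodeNat] at h
    set M : ℕ := (if N % 2 = 0 then N / 2 else N) with hM
    obtain ⟨hModd, hMsq⟩ := odd_and_squarefree_half hsq
    rw [← hM] at hModd hMsq
    have hMle : M ≤ N := by rw [hM]; split_ifs <;> omega
    have hMlt : M < 2 ^ (encodeNat N).length := lt_of_le_of_lt hMle hNlt
    set U : ℕ := (if M % 3 = 2 then 6 * M * 2 ^ (3 * (encodeNat N).length + 32) - 1
      else 6 * M * 2 ^ (3 * (encodeNat N).length + 32) + 1) with hU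
    have hd := hdens (encodeNat N).length hn M hModd hMlt
    dsimp only at hd
    rw [← hU] at hd
    have hq : (4 : Polynomial ℕ).eval (encodeNat N).length = 4 := by simp
    rw [hq]
    refine hd.trans (Nat.mul_le_mul_left _ ?_)
    have e : ((Finset.range (2 ^ (6 * (encodeNat N).length + 60))).filter (fun j =>
        M * (1 + 6 * M * U * j) ≤ U ^ 3 ∧ Squarefree (1 + 6 * M * U * j) ∧
          Squarefree (2 * U ^ 3 - M * (1 + 6 * M * U * j)))).card =
        (univ.filter (fun r : Fin (6 * (encodeNat N).length + 60) → Bool =>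
          M * (1 + 6 * M * U * bitsToNat (List.ofFn r)) ≤ U ^ 3 ∧
            Squarefree (1 + 6 * M * U * bitsToNat (List.ofFn r)) ∧
            Squarefree (2 * U ^ 3 - M * (1 + 6 * M * U * bitsToNat (List.ofFn r))))).card := by
      convert (card_filter_seeds (6 * (encodeNat N).length + 60) (fun j =>
        M * (1 + 6 * M * U * j) ≤ U ^ 3 ∧ Squarefree (1 + 6 * M * U * j) ∧
          Squarefree (2 * U ^ 3 - M * (1 + 6 * M * U * j)))).symm using 3
    refine le_of_eq_of_le e (Finset.card_le_card fun r hr => ?_)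
    rw [Finset.mem_filter] at hr ⊢
    refine ⟨Finset.mem_univ _, ?_⟩
    obtain ⟨hle, hs, hw⟩ := hr.2
    rw [hcanon, hfval, bitsToNat_encodeNat, encodeNat_mem_toLanguage_iff]
    have hhit := stub_cubeHit stub_orderThreeCert (encodeNat N).length M
      (bitsToNat (List.ofFn r)) hModd hMsq
    dsimp only at hhit
    rw [← hU] at hhit
    have hhit' := hhit hle hs hw
    change cubeD N (encodeNat N).length (bitsToNat (List.ofFn r)) ∈ iqThreeSet
    unfold cubeD
    dsimp only
    rw [← hM, ← hU, if_neg h4]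
    exact hhit'

/-! ## The composition: the crux BY NAME, modulo the registered stubs -/

/-- **`IqThreeNotBPP_of`**: the line concludes the crux `ArithStatLadder.IqThreeNotBPP` by name from
the registered stubs (`stub_rurClosureBPP`, `stub_samplerCubeFP`, `stub_cubeDensity`, `stub_cubeHit`,
`stub_orderThreeCert` enter through `toLanguage_squarefree_mem_BPP_of_iqThree_cube`; the one socket is
the apex `stub_sqfreeNotBPP`). The ONLY theorem of this file concluding the crux. -/
theorem IqThreeNotBPP_of : IqThreeNotBPP :=
  fun hIQ => stub_sqfreeNotBPP (toLanguage_squarefree_mem_BPP_of_iqThree_cube hIQ)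

/-! ## By-products (to be landed as theorems; stated on the unfolded crux so that `IqThreeNotBPP_of`
stays the only decl concluding the crux by name) -/

/-- The crux is literally `IQ3 ∉ BPP` (definitional). -/
theorem iqThreeNotBPP_iff : IqThreeNotBPP ↔ encodingNatBool.toLanguage iqThreeSet ∉ BPP :=
  Iff.rfl

/-- **The crux from the apex, unconditionally: `SQUAREFREES ∉ BPP → IQ3 ∉ BPP`** (no named fact;
in the landed file the conclusion is stated as `IqThreeNotBPP`). -/
theorem not_mem_BPP_of_squarefree_not_mem_BPP
    (hX : encodingNatBool.toLanguage {m : ℕ | Squarefree m} ∉ BPP) :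
    encodingNatBool.toLanguage iqThreeSet ∉ BPP :=
  fun hIQ => hX (toLanguage_squarefree_mem_BPP_of_iqThree_cube hIQ)

/-- **The refutation floor, unconditionally**: a refutation of the crux (a `BPP` algorithm for
`3 ∣ h(−d)` on fundamental `−d`) puts SQUAREFREENESS TESTING in `BPP` — uniformly, no advice, no
class field theory; the apex is not used. -/
theorem toLanguage_squarefree_mem_BPP_of_not_iqThreeNotBPP (h : ¬ IqThreeNotBPP) :
    encodingNatBool.toLanguage {m : ℕ | Squarefree m} ∈ BPP :=
  toLanguage_squarefree_mem_BPP_of_iqThree_cube (not_not.1 h)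

end Summit.QuantumAdvantage.QuantumAdvantage.Cruxes.IqThreeNotBPP.Sketch

end
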